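import Mathlib
import HarnessLib
import Summits.HubbardSuperconductivity.HubbardSuperconductivity.Theorems.KLProgrammeC4aAbsBubbleDominatorExists
import Summits.HubbardSuperconductivity.HubbardSuperconductivity.Theorems.KLProgrammeC4aAbsBubbleDominatorNeg

/-!
# Route `KLProgramme` — crux C4a, S3 brick (B4)/(B5) «(B4)-DIRECT-PACK» / «(U1)-HYBRID» B-1: the ∃-FORM OF THE `k = 0` DOMINATOR FOR BOTH SIGNS OF THE LOOP LEVEL AND
# EVERY LEVEL CEILING `hi ≤ hi₀` — one set of constants `K₀, P, M` serves all smaller tubes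

Cell `gate-hubbard-kl`, seat hubbard-kl-k3c3-p3 (g37; row «implicit-function / monotonicity route for μ(n)»).  Located brick for the (C)-closer lane / the `M₁`
assembly (stub (C) `stub_twoLeg_curvature` of `KLRegimeEngineV17F2`, stmt-HubbardSuperconductivity-20437), memo HOME/hubbard-kl-k3c3-p3/U1-CAUSTIC-SUP.md §19 (B-1).

WHY.  The direct tangency / Cooper parts of the first-order layer (D-2c `…C4aUmkDirectTangencyLine`, D-3d `…C4aUmkDirectCooperLine`) are bounded per level line by the
`k = 0` envelope line; their level and `ϑ` layers are the `k = 0` dominator (`…C4aAbsBubbleDominator[Neg]`).  The consumer's level ceiling `hi` is the tube radius of the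
bubble's level partition (U7's `hi`), not the dominator's internal one, and the loop levels run over BOTH signs.  `…C4aAbsBubbleDominatorExists.exists_absBubble_dominator`
fixes its own `hi` and covers positive levels only.  Here: every threshold of `exists_absBubble_thresholds` is MONOTONE in `hi` (smaller ceilings only help) and the bound
`K₀(hi) + P·log⁺(M(hi)/‖ϑ−π‖_𝕋)` is monotone too, so the witnesses at `hi₀` serve every `hi ≤ hi₀`; and the negative-level twin has the identical hypothesis list.
* **`exists_absBubble_dominator_upto`**: `∃ hi₀ K₀ P M`, `0 < hi₀ < r`, `K₀, P ≥ 0`, such that for all `0 < hi ≤ hi₀`, `|ρ| < r`, `θ`, `0 < lo ≤ hi`, floors `t ≥ id`,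
  weights `0 ≤ wt ≤ W` and `‖ϑ − π‖_𝕋 > 0`, BOTH `∫_{lo..hi} wt(e)·(∫_{[a,b]} dx/max(t e, |ē(e,x)|)) de` and the same with the loop level `−e` are
  `≤ K₀ + P·log⁺(M/‖ϑ − π‖_𝕋)`.
Pure bookkeeping on landed objects; nothing asserts (C), K3 or superconductivity.
References: Salmhofer 1999 §4.5.3 Cor. 4.11 [cite: Salmhofer1999]; FST II CPAM 51 (1998) §3 [cite: FeldmanSalmhoferTrubowitz1998]; BGM 2006 §2.4 (2.36)
[cite: BenfattoGiulianiMastropietro2006].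
-/

noncomputable section

namespace Summit.HubbardSuperconductivity.HubbardSuperconductivity.Theorems.C4a

set_option linter.dupNamespace false -- summit = problem name (single-conjunct summit), D-0017

open Real Set MeasureTheory
open Literature.MathematicalPhysics.QuantumLattice Literature.MathematicalPhysics.QuantumLattice.BandSectorCounting
open Literature.MathematicalPhysics.QuantumLattice.FermiRG
open Summit.HubbardSuperconductivity.HubbardSuperconductivity.Theorems.KLRegimeSplit
open Summit.HubbardSuperconductivity.HubbardSuperconductivity.Theorems.DispersionFlow
open Summit.HubbardSuperconductivity.HubbardSuperconductivity.Theorems.PerturbedFermiCurve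

section Sizes

variable {K : TrigPolyC4v} {A : ℝ} (hA : ∀ p : Momentum, ∀ j ≤ 2, ‖iteratedFDeriv ℝ j (frameShift K) p‖ ≤ A) (hA20 : A ≤ 1 / 20)
  (hd : klCurveD ≤ (bandBounds (show (-4 : ℝ) < -1.1 by norm_num) (show (-1.1 : ℝ) ≤ -0.1 by norm_num)
    (show (-0.1 : ℝ) < 0 by norm_num)).Dtmin - 2 * A)
  {μ r : ℝ} (hr : 0 < r) (hlo : (-1.1 : ℝ) < μ - r - A) (hhi : μ + r + A < -0.1)
  {A₃ A₄ : ℝ} (hA₃ : ∀ p : Momentum, ‖iteratedFDeriv ℝ 3 (frameShift K) p‖ ≤ A₃)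
  (hA₄ : ∀ p : Momentum, ‖iteratedFDeriv ℝ 4 (frameShift K) p‖ ≤ A₄)
  {K₁ K₂ K₃ : ℝ} (hK₁ : ∀ p : Momentum, ‖fderiv ℝ (frameLevel μ K) p‖ ≤ K₁) (hK₂ : ∀ p : Momentum, ‖iteratedFDeriv ℝ 2 (frameLevel μ K) p‖ ≤ K₂)
  (hK₃ : ∀ p : Momentum, ‖iteratedFDeriv ℝ 3 (frameLevel μ K) p‖ ≤ K₃)
include hA hA20 hd hr hlo hhi hA₃ hA₄ hK₁ hK₂ hK₃

/-- **THE ∃-FORM OF THE pp DOMINATOR, BOTH LEVEL SIGNS, EVERY CEILING `hi ≤ hi₀`** (see the module docstring). [cite: Salmhofer1999, §4.5.3 Cor. 4.11] -/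
theorem exists_absBubble_dominator_upto {Kc r₀ g₀ w : ℝ} (hG : GeomConstants (frameLevel μ K) Kc r₀ g₀ w) (hK₁0 : 0 < K₁) (hK₂0 : 0 < K₂)
    {a b W : ℝ} (hab : a ≤ b) (hW : 0 ≤ W) :
    ∃ hi₀ K₀ P M : ℝ, 0 < hi₀ ∧ hi₀ < r ∧ 0 ≤ K₀ ∧ 0 ≤ P ∧
      ∀ (hi ρ θ lo : ℝ) (t wt : ℝ → ℝ), 0 < hi → hi ≤ hi₀ → |ρ| < r → 0 < lo → lo ≤ hi → (∀ e ∈ Icc lo hi, e ≤ t e) → (∀ e ∈ Icc lo hi, 0 ≤ wt e) →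
        (∀ e ∈ Icc lo hi, wt e ≤ W) → ∀ ϑ : ℝ, 0 < torusDist (ϑ - π) →
          (∫ e in lo..hi, wt e * ∫ x in Icc a b, (max (t e) |frameLevel μ K (pairSumPath μ K ρ ϑ θ 0 - levelPoint μ K e (x + θ))|)⁻¹) ≤
              K₀ + P * log⁺ (M / torusDist (ϑ - π)) ∧
            (∫ e in lo..hi, wt e * ∫ x in Icc a b, (max (t e) |frameLevel μ K (pairSumPath μ K ρ ϑ θ 0 - levelPoint μ K (-e) (x + θ))|)⁻¹) ≤
              K₀ + P * log⁺ (M / torusDist (ϑ - π)) := by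
  obtain ⟨c₀, c₁, sC, d₁, κ, hi₀, hc₀, hc₁, hsC, hd₁, hκ, hhi0, hhir₀, hX, hwinC, hwinC', hhirC, hs₀, hs₀', hhirT, hsmall⟩ :=
    exists_absBubble_thresholds hA hd hr hA₃ hK₁ hK₂ hK₃ hG
  -- cell counts (independent of the ceiling)
  obtain ⟨NC, hNC⟩ := exists_nat_mul_ge ((b - a) * (4 * (K₂ * msD A₃ A₄ 1))) hc₀
  obtain ⟨NT₁, hNT₁⟩ := exists_nat_mul_ge ((b - a) * (4 * (K₁ * msD A₃ A₄ 1))) hκ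
  obtain ⟨NT₂, hNT₂⟩ := exists_nat_mul_ge ((b - a) * (4 * (K₂ * msD A₃ A₄ 1 ^ 2 + K₁ * msD A₃ A₄ 2))) hd₁
  set NT := max NT₁ NT₂ with hNTdef
  have hNT : (b - a) * (4 * (K₁ * msD A₃ A₄ 1)) ≤ NT * κ :=
    hNT₁.trans (mul_le_mul_of_nonneg_right (by exact_mod_cast le_max_left NT₁ NT₂) hκ.le)
  have hNT' : (b - a) * (4 * (K₂ * msD A₃ A₄ 1 ^ 2 + K₁ * msD A₃ A₄ 2)) ≤ NT * d₁ :=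
    hNT₂.trans (mul_le_mul_of_nonneg_right (by exact_mod_cast le_max_right NT₁ NT₂) hd₁.le)
  have hhir : hi₀ < r := by have := mul_pos hc₀ hsC; linarith only [this, hhirC]
  set B := bandBounds (show (-4 : ℝ) < -1.1 by norm_num) (show (-1.1 : ℝ) ≤ -0.1 by norm_num) (show (-0.1 : ℝ) < 0 by norm_num) with hBdef
  have hupos := B.umin_pos
  have hwpos := hG.wmin_pos
  have hDt : 0 < B.Dtmin - 2 * A := by have := klCurveD_pos; linarith only [this, hd]
  have hA0 : 0 ≤ A := (norm_nonneg _).trans (hA 0 0 (by norm_num))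
  have hA₃0 : 0 ≤ A₃ := (norm_nonneg _).trans (hA₃ 0)
  have hK₃0 : 0 ≤ K₃ := (norm_nonneg _).trans (hK₃ 0)
  have hM1 : 0 < msD A₃ A₄ 1 := msD_one_pos A₃ A₄
  have hM2 : 0 < msD A₃ A₄ 2 := msD_two_pos A₃ A₄
  have hRR : 0 ≤ radialRowOneConst A (B.Dtmin - 2 * A) := radialRowOneConst_nonneg hA0 hDt
  have hC2 : 0 ≤ uRowTwoConst A A₃ (B.Dtmin - 2 * A) + 1 / (B.Dtmin - 2 * A) + 2 * (radialRowOneConst A (B.Dtmin - 2 * A) - 1 / (B.Dtmin - 2 * A)) := by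
    have := uRowTwoConst_nonneg hA0 hA₃0 hDt
    have := radialRowOneConst_sub_inv_nonneg hA0 hDt
    positivity
  have hposlog : ∀ y : ℝ, 0 ≤ log⁺ y := fun y => Real.posLog_nonneg
  refine ⟨hi₀,
    W * ((4 * (b - a) / κ + 2 * (NT * (4 / d₁))) * (κ / 2) +
          2 * (12 * NT / Real.sqrt (w * B.umin ^ 2)) * Real.sqrt (κ / 2) + (b - a) * log⁺ (hi₀ / (κ / 2))) +
      W * (2 * (b - a) + 2 * (NC * c₀ / c₁)),
    W * (b - a), π * hi₀ / (c₀ * B.umin), hhi0, hhir, ?_, mul_nonneg hW (by linarith), ?_⟩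
  · have := hposlog (hi₀ / (κ / 2))
    positivity
  intro hi ρ θ lo t wt hhipos hhile hρ hlo0 hlohi ht hw0 hw ϑ hϑ
  -- the thresholds at the smaller ceiling
  have hd2 : 2 * hi / (B.Dtmin - 2 * A) ≤ 2 * hi₀ / (B.Dtmin - 2 * A) := div_le_div_of_nonneg_right (by linarith) hDt.le
  have hwinC₁ : sC * ((msD A₃ A₄ 1 * ((π / 2 * c₁ / ((B.Dtmin - 2 * A) * B.umin) + π * Kc * c₀ / (B.Dtmin - 2 * A) ^ 2) / (B.umin * w / (4 + 2 * A)))) +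
      c₀ / (B.Dtmin - 2 * A)) + 2 * hi / (B.Dtmin - 2 * A) + sC < 3 / 5 := by linarith only [hwinC, hd2]
  have hwinC₁' : sC * ((msD A₃ A₄ 1 * ((π / 2 * c₁ / ((B.Dtmin - 2 * A) * B.umin) + π * Kc * c₀ / (B.Dtmin - 2 * A) ^ 2) / (B.umin * w / (4 + 2 * A)))) +
      c₀ / (B.Dtmin - 2 * A)) + 2 * hi / (B.Dtmin - 2 * A) + sC < 2 * B.umin := by linarith only [hwinC', hd2]
  have hhirC₁ : hi + c₀ * sC < r := by linarith only [hhirC, hhile]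
  have hhirT₁ : hi + κ < r := by linarith only [hhirT, hhile]
  have hhir₀₁ : hi < r₀ := by linarith only [hhir₀, hhile]
  -- the monotone comparison of the two bounds
  have hmono : W * ((4 * (b - a) / κ + 2 * (NT * (4 / d₁))) * (κ / 2) + 2 * (12 * NT / Real.sqrt (w * B.umin ^ 2)) * Real.sqrt (κ / 2) +
          (b - a) * log⁺ (hi / (κ / 2))) + W * (2 * (b - a) + 2 * (NC * c₀ / c₁)) +
        W * (b - a) * log⁺ (π * hi / (c₀ * B.umin) / torusDist (ϑ - π)) ≤
      W * ((4 * (b - a) / κ + 2 * (NT * (4 / d₁))) * (κ / 2) + 2 * (12 * NT / Real.sqrt (w * B.umin ^ 2)) * Real.sqrt (κ / 2) +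
          (b - a) * log⁺ (hi₀ / (κ / 2))) + W * (2 * (b - a) + 2 * (NC * c₀ / c₁)) +
        W * (b - a) * log⁺ (π * hi₀ / (c₀ * B.umin) / torusDist (ϑ - π)) := by
    have h1 : log⁺ (hi / (κ / 2)) ≤ log⁺ (hi₀ / (κ / 2)) :=
      Real.posLog_le_posLog (by positivity) (div_le_div_of_nonneg_right hhile (by positivity))
    have h2 : log⁺ (π * hi / (c₀ * B.umin) / torusDist (ϑ - π)) ≤ log⁺ (π * hi₀ / (c₀ * B.umin) / torusDist (ϑ - π)) :=
      Real.posLog_le_posLog (by positivity) (div_le_div_of_nonneg_right (div_le_div_of_nonneg_right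
        (mul_le_mul_of_nonneg_left hhile Real.pi_pos.le) (by positivity)) hϑ.le)
    have hba : 0 ≤ b - a := by linarith only [hab]
    exact add_le_add (add_le_add (mul_le_mul_of_nonneg_left (add_le_add le_rfl (mul_le_mul_of_nonneg_left h1 hba)) hW) le_rfl)
      (mul_le_mul_of_nonneg_left h2 (mul_nonneg hW hba))
  constructor
  · refine le_trans (absBubble_partnerBand_le_posLog hA hA20 hd hr hlo hhi hA₃ hA₄ hK₁ hK₂ hK₃ hG hK₁0 hK₂0 hρ hab hlo0 hlohi hhir₀₁ hc₀ hc₁ hX hwinC₁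
      hwinC₁' hhirC₁ hNC hd₁ hκ hs₀ hs₀' hhirT₁ ?_ hNT hNT' ht hW hw0 hw hϑ) hmono
    refine le_trans ?_ hsmall
    gcongr
  · refine le_trans (absBubble_partnerBand_le_posLog_neg hA hA20 hd hr hlo hhi hA₃ hA₄ hK₁ hK₂ hK₃ hG hK₁0 hK₂0 hρ hab hlo0 hlohi hhir₀₁ hc₀ hc₁ hX hwinC₁
      hwinC₁' hhirC₁ hNC hd₁ hκ hs₀ hs₀' hhirT₁ ?_ hNT hNT' ht hW hw0 hw hϑ) hmono
    refine le_trans ?_ hsmall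
    gcongr

end Sizes

end Summit.HubbardSuperconductivity.HubbardSuperconductivity.Theorems.C4a

end
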